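import Summits.CriticalPhenomena.PercolationContinuityZ3.Theorems.PercNearOneGluingNoHeavyQuantHeavyShift
import HarnessLib

/-!
# QUANT lane R8, T-DEC: A FOUR-ATOM LAW `{0, k, 2k, 3k}` OF MEAN `s·k` IS HEAVY-DEC AT FLOOR `s/3` — the three regimes `s ≤ 1`,
# `1 < s ≤ 2`, `2 < s < 3` (explicit heavy decompositions), and the two polynomial inequalities of the blob case (prim-quant-census-2 gen 80)

builds on p205010 (kernel theorem, internal audit signed; external expert review pending)

Support file (`--supports stmt-CriticalPhenomena-4575`), QUANT lane census seat prim-quant-census-2 (gen 80); memo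
`run/shared/lean/prim/quant/prim-quant-census-2-g80/TRIPLE-G80.md` §2–§3.  Theorems only, standard axioms, no sorries, no definitions.

THIS FILE: the regime lemmas **`heavy_fourAtoms_small`**, **`heavy_fourAtoms_mid`**, **`heavy_fourAtoms_large`** for an abstract
four-atom law `p₀δ₀ + p₁δ_k + p₂δ_{2k} + p₃δ_{3k}` of mean `s·k` (floor `s/3`, target `s·k`), and the two polynomial inequalities
**`threeBlobs_ineq_zero`**, **`threeBlobs_ineq_lows`** that feed the third regime for the blob weights; assembled in `…QuantBlobAverageFloor`.
THE BLOB LEMMA (`heavy_threeBlobs`, next file).  The law of `k·(ξ₁ + ξ₂ + ζ)`, `ξᵢ ~ Bernoulli(g)`, `ζ ~ Bernoulli(c·g)` independent — written as the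
mixture `(1−c)·[k·Bin(2,g)] + c·[k·Bin(3,g)]` on the atoms `0, k, 2k, 3k` — carries a HEAVY decomposition (`…QuantHeavyShift`: pairs with gate
`≥ x` and credit `≥ T`, self-sufficient points) at the floor `x = (2+c)g/3` = the AVERAGE gate = mean/top, and the target `T = (2+c)g·k` = its mean.
Three regimes: `(2+c)g ≤ 1` — the zero atom is absorbed EXACTLY by `k, 2k, 3k` at the credit gates `3x, 3x/2, x` (the identity
`Σ_b b·p_b = 3x`); `1 < (2+c)g ≤ 2` — `k` stands alone, the zero is absorbed by `2k, 3k` (slack `p₁((2+c)g − 1)`); `(2+c)g > 2` — the lows `0` and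
`k` ship to `3k` and `2k, 3k` at the floor gate (two polynomial inequalities in `(c, g)`).
THE LIFT (**`decAtT_twoSureOneGated`**).  `X_c = ρ ∗ ρ ∗ gate_c ρ`, `ρ = blobLaw [(k,g),(r,1)]`, is the blob law above with the gated copy's
atoms moved up by `r` (a PARTIAL shift, `heavy_shift_partial`: same target) and everything moved up by `2r` (a FULL shift, `heavy_shift_full`:
target `+4r ≥ (2+c)r`); hence `X_c` is `DECAtT ((2+c)g/3) ((2+c)(r+kg)) j` at EVERY layer `j` — the floor `(2+c)g/3` is ABOVE the natural floor
`c·g` of the forest.  No `ConvClosedT` budget split achieves this for long tails (`k ≥ 30r`, memo §1): the blobs of the sure copies must absorb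
the gated copy's deficit jointly, which is what the blob lemma does.  USE: the polarized component of the identical glued triple's outer-gate
mixture (`…QuantGluedTripleTrueFloor`).

HONEST STATUS.  `SiblingStep`, `FarTreeRow` OPEN; RATE class (log\*) / honest sentence of `run/shared/lean/prim/quant/README.md` unchanged.
[this work].  Nothing here is cited as a published result.  The gluing rows served [cite: KozmaNitzan2024, Conjecture 3 (p. 15)]; product
measure [cite: Grimmett1999, §1.3 p. 10].
-/

noncomputable section

open scoped BigOperators

namespace Summit.CriticalPhenomena.PercolationContinuityZ3.Theorems
namespace Quant

open Finset

/-- the two-point law `{lo, hi; g}` (as in `…QuantLawDEC`) -/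
local notation3 "TP[" lo ", " hi ", " g ", " h "]" =>
  (g : ℝ) * (if (h : ℕ) = (hi : ℕ) then (1 : ℝ) else 0) + (1 - (g : ℝ)) * (if (h : ℕ) = (lo : ℕ) then (1 : ℝ) else 0)

namespace LawDec

/-! ### Two polynomial inequalities (the regime `(2+c)g > 2` of the blob lemma) -/

/-- regime `(2+c)g > 2`, inequality (b): `x·(p₀ + p₁) ≤ (1−x)·(p₂ + p₃)` — the lows `0, k` fit into `2k, 3k` at the floor gate. [this work] -/
theorem threeBlobs_ineq_lows (c g : ℝ) (hc0 : 0 < c) (hc1 : c ≤ 1) (hg0 : 0 < g) (hg1 : g < 1) (hx : 2 < (2 + c) * g) :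
    (2 + c) * g / 3 * ((1 - g) ^ 2 * (1 - c * g) + g * (1 - g) * (2 + c - 3 * c * g))
      ≤ (1 - (2 + c) * g / 3) * (g ^ 2 * (1 + 2 * c - 3 * c * g) + c * g ^ 3) := by
  have key : (2 + c) ≤ 3 * g * (1 + 2 * c - 2 * c * g) := by
    nlinarith [mul_nonneg (by linarith : 0 ≤ (2 + c) * g - 2) (by linarith : 0 ≤ 1 - g), mul_nonneg hc0.le (by linarith : 0 ≤ 1 - g),
      mul_nonneg (mul_nonneg hc0.le (by linarith : 0 ≤ (2 + c) * g - 2)) (by linarith : 0 ≤ 1 - g)]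
  have hsum : (1 - g) ^ 2 * (1 - c * g) + g * (1 - g) * (2 + c - 3 * c * g)
      = 1 - (g ^ 2 * (1 + 2 * c - 3 * c * g) + c * g ^ 3) := by ring
  have e2 : g ^ 2 * (1 + 2 * c - 3 * c * g) + c * g ^ 3 = g ^ 2 * (1 + 2 * c - 2 * c * g) := by ring
  rw [hsum, e2]
  have hxq : (2 + c) * g / 3 ≤ g ^ 2 * (1 + 2 * c - 2 * c * g) := by
    have := mul_le_mul_of_nonneg_left key hg0.le
    nlinarith
  have hx0 : 0 ≤ (2 + c) * g / 3 := by positivity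
  have hq1 : g ^ 2 * (1 + 2 * c - 2 * c * g) ≤ 1 := by nlinarith [mul_pos hc0 hg0]
  nlinarith

/-- regime `(2+c)g > 2`, inequality (a): `x·p₀ ≤ (1−x)·p₃` — the zero atom fits into the top `3k` at the floor gate. [this work] -/
theorem threeBlobs_ineq_zero (c g : ℝ) (hc0 : 0 < c) (hc1 : c ≤ 1) (hg0 : 0 < g) (hg1 : g < 1) (hx : 2 < (2 + c) * g) :
    (2 + c) * g / 3 * ((1 - g) ^ 2 * (1 - c * g)) ≤ (1 - (2 + c) * g / 3) * (c * g ^ 3) := by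
  have h3 : (2 + c) * (1 - g) ≤ 3 - (2 + c) * g := by nlinarith
  have key : (2 + c) * (1 - g) ^ 2 * (1 - c * g) ≤ (3 - (2 + c) * g) * c * g ^ 2 := by
    have hu : (2 + c) * (1 - g) < c := by nlinarith
    have h1 : (2 + c) * (1 - c * g) < 2 - c := by nlinarith
    have h2 : 4 < (2 + c) ^ 2 * g ^ 2 := by nlinarith
    nlinarith [mul_pos hc0 hg0, mul_nonneg (mul_nonneg (by linarith : 0 ≤ 1 - g) (by linarith : 0 ≤ 1 - g)) (by nlinarith : 0 ≤ 1 - c * g),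
      mul_le_mul_of_nonneg_right h3 (by positivity : (0:ℝ) ≤ c * g ^ 2)]
  have := mul_le_mul_of_nonneg_left key hg0.le
  nlinarith

/-! ### A four-atom law `{0, k, 2k, 3k}` of mean `s·k` at floor `s/3`: three regimes -/

/-- regime `s ≤ 1`: the zero atom ships to `k`, `2k`, `3k` at the credit gates `s, s/2, s/3` — exactly (`Σ_b b·p_b = s`). [this work] -/
theorem heavy_fourAtoms_small (k : ℕ) (p₀ p₁ p₂ p₃ s : ℝ) (hp₀0 : 0 ≤ p₀) (hp₁0 : 0 ≤ p₁) (hp₂0 : 0 ≤ p₂)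
    (hp₃0 : 0 ≤ p₃) (hsum : p₀ + p₁ + p₂ + p₃ = 1) (hmean : p₁ + 2 * p₂ + 3 * p₃ = s) (hs0 : 0 < s) (h1 : s ≤ 1) :
    ∃ (ι : Type) (_ : Fintype ι) (lam γ : ι → ℝ) (lo hi : ι → ℕ),
      (∀ i, 0 ≤ lam i) ∧ (∑ i, lam i = 1) ∧ (∀ i, 0 ≤ γ i ∧ γ i ≤ 1) ∧ (∀ i, lo i ≤ hi i) ∧ (∀ i, hi i ≤ 3 * k) ∧
      (∀ h, (p₀ * (if h = 0 then (1 : ℝ) else 0) + p₁ * (if h = k then (1 : ℝ) else 0) + p₂ * (if h = 2 * k then (1 : ℝ) else 0)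
          + p₃ * (if h = 3 * k then (1 : ℝ) else 0)) = ∑ i, lam i * TP[lo i, hi i, γ i, h]) ∧
      (∀ i, 0 < lam i → s / 3 ≤ γ i ∧ s * k ≤ 2 * (lo i : ℝ) + ((hi i : ℝ) - lo i) * γ i) := by
  have hk0 : (0 : ℝ) ≤ k := Nat.cast_nonneg k
  have hsne : s ≠ 0 := hs0.ne'
  have c2k : ((2 * k : ℕ) : ℝ) = 2 * (k : ℝ) := by push_cast; ring
  have c3k : ((3 * k : ℕ) : ℝ) = 3 * (k : ℝ) := by push_cast; ring
  have hγ₂0 : 0 < s / 2 := by positivity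
  have hγ₃0 : 0 < s / 3 := by positivity
  refine ⟨Fin 3, inferInstance, ![p₁ / s, p₂ / (s / 2), p₃ / (s / 3)], ![s, s / 2, s / 3], ![0, 0, 0], ![k, 2 * k, 3 * k],
    ?_, ?_, ?_, ?_, ?_, fun h => ?_, ?_⟩
  · intro i; fin_cases i
    · exact div_nonneg hp₁0 hs0.le
    · exact div_nonneg hp₂0 hγ₂0.le
    · exact div_nonneg hp₃0 hγ₃0.le
  · rw [Fin.sum_univ_three]
    show p₁ / s + p₂ / (s / 2) + p₃ / (s / 3) = 1
    have e : p₁ / s + p₂ / (s / 2) + p₃ / (s / 3) = (p₁ + 2 * p₂ + 3 * p₃) / s := by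
      field_simp
    rw [e, hmean, div_self hs0.ne']
  · intro i; fin_cases i
    · exact ⟨hs0.le, h1⟩
    · exact ⟨hγ₂0.le, by show s / 2 ≤ 1; linarith⟩
    · exact ⟨hγ₃0.le, by show s / 3 ≤ 1; linarith⟩
  · intro i; fin_cases i <;> exact Nat.zero_le _
  · intro i; fin_cases i
    · show k ≤ 3 * k; omega
    · show 2 * k ≤ 3 * k; omega
    · exact le_rfl
  · rw [Fin.sum_univ_three]
    show _ = p₁ / s * TP[0, k, s, h] + p₂ / (s / 2) * TP[0, 2 * k, s / 2, h] + p₃ / (s / 3) * TP[0, 3 * k, s / 3, h]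
    have e1 : p₁ / s * s = p₁ := div_mul_cancel₀ p₁ hs0.ne'
    have e2 : p₂ / (s / 2) * (s / 2) = p₂ := div_mul_cancel₀ p₂ hγ₂0.ne'
    have e3 : p₃ / (s / 3) * (s / 3) = p₃ := div_mul_cancel₀ p₃ hγ₃0.ne'
    have e0 : p₁ / s * (1 - s) + p₂ / (s / 2) * (1 - s / 2) + p₃ / (s / 3) * (1 - s / 3) = p₀ := by
      have : p₁ / s * (1 - s) + p₂ / (s / 2) * (1 - s / 2) + p₃ / (s / 3) * (1 - s / 3)
          = (p₁ + 2 * p₂ + 3 * p₃) / s - (p₁ + p₂ + p₃) := by field_simp; ring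
      rw [this, hmean, div_self hs0.ne']; linarith
    linear_combination (-(if h = k then (1 : ℝ) else 0)) * e1 - (if h = 2 * k then (1 : ℝ) else 0) * e2
      - (if h = 3 * k then (1 : ℝ) else 0) * e3 - (if h = 0 then (1 : ℝ) else 0) * e0
  · intro i hi
    clear hi
    fin_cases i
    · show s / 3 ≤ s ∧ s * k ≤ 2 * ((0 : ℕ) : ℝ) + ((k : ℝ) - ((0 : ℕ) : ℝ)) * s
      push_cast
      exact ⟨by linarith, by linarith⟩
    · show s / 3 ≤ s / 2 ∧ s * k ≤ 2 * ((0 : ℕ) : ℝ) + (((2 * k : ℕ) : ℝ) - ((0 : ℕ) : ℝ)) * (s / 2)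
      rw [c2k]; push_cast
      exact ⟨by linarith, by linarith⟩
    · show s / 3 ≤ s / 3 ∧ s * k ≤ 2 * ((0 : ℕ) : ℝ) + (((3 * k : ℕ) : ℝ) - ((0 : ℕ) : ℝ)) * (s / 3)
      rw [c3k]; push_cast
      exact ⟨le_rfl, by linarith⟩

/-- regime `1 < s ≤ 2`: `k` stands alone; the zero ships to `2k`, `3k` at the gates `s/2`, `s/3` (slack `p₁(s−1)/s`). [this work] -/
theorem heavy_fourAtoms_mid (k : ℕ) (p₀ p₁ p₂ p₃ s : ℝ) (hp₀0 : 0 ≤ p₀) (hp₁0 : 0 ≤ p₁) (hp₂0 : 0 ≤ p₂)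
    (hp₃0 : 0 ≤ p₃) (hsum : p₀ + p₁ + p₂ + p₃ = 1) (hmean : p₁ + 2 * p₂ + 3 * p₃ = s) (hs0 : 0 < s) (h1 : 1 < s) (h2 : s ≤ 2) :
    ∃ (ι : Type) (_ : Fintype ι) (lam γ : ι → ℝ) (lo hi : ι → ℕ),
      (∀ i, 0 ≤ lam i) ∧ (∑ i, lam i = 1) ∧ (∀ i, 0 ≤ γ i ∧ γ i ≤ 1) ∧ (∀ i, lo i ≤ hi i) ∧ (∀ i, hi i ≤ 3 * k) ∧
      (∀ h, (p₀ * (if h = 0 then (1 : ℝ) else 0) + p₁ * (if h = k then (1 : ℝ) else 0) + p₂ * (if h = 2 * k then (1 : ℝ) else 0)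
          + p₃ * (if h = 3 * k then (1 : ℝ) else 0)) = ∑ i, lam i * TP[lo i, hi i, γ i, h]) ∧
      (∀ i, 0 < lam i → s / 3 ≤ γ i ∧ s * k ≤ 2 * (lo i : ℝ) + ((hi i : ℝ) - lo i) * γ i) := by
  have hk0 : (0 : ℝ) ≤ k := Nat.cast_nonneg k
  have hsne : s ≠ 0 := hs0.ne'
  have c2k : ((2 * k : ℕ) : ℝ) = 2 * (k : ℝ) := by push_cast; ring
  have c3k : ((3 * k : ℕ) : ℝ) = 3 * (k : ℝ) := by push_cast; ring
  obtain ⟨x, hx⟩ : ∃ x : ℝ, x = s / 3 := ⟨_, rfl⟩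
  have hx0 : 0 < x := by rw [hx]; positivity
  have hx1 : x < 1 := by rw [hx]; linarith
  have hxne : x ≠ 0 := hx0.ne'
  have hγ₂0 : 0 < s / 2 := by positivity
  have hγ₂1 : s / 2 ≤ 1 := by linarith
  -- capacities of `2k`, `3k` for the zero atom, and the filling fraction `t`
  obtain ⟨D, hD⟩ : ∃ D : ℝ, D = p₂ / (s / 2) * (1 - s / 2) + p₃ / x * (1 - x) := ⟨_, rfl⟩
  have hsD : s * D = 2 * p₂ + 3 * p₃ - s * (p₂ + p₃) := by rw [hD, hx]; field_simp; ring
  have hDp : s * (D - p₀) = p₁ * (s - 1) := by linear_combination hsD + hmean - s * hsum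
  have hDp0 : p₀ ≤ D := by
    have h' : s * p₀ ≤ s * D := by nlinarith [mul_nonneg hp₁0 (by linarith : (0 : ℝ) ≤ s - 1)]
    exact le_of_mul_le_mul_left h' hs0
  have hD0 : 0 ≤ D := hp₀0.trans hDp0
  -- `t = p₀ / D` when `D > 0`; when `D = 0` also `p₀ = 0` and any `t ∈ [0,1]` works: take `t = 0`
  obtain ⟨t, ht0, ht1, htD⟩ : ∃ t : ℝ, 0 ≤ t ∧ t ≤ 1 ∧ t * D = p₀ := by
    rcases hD0.eq_or_lt with hz | hz
    · refine ⟨0, le_rfl, zero_le_one, ?_⟩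
      rw [zero_mul]; linarith [hz ▸ hDp0]
    · exact ⟨p₀ / D, div_nonneg hp₀0 hD0, (div_le_one hz).2 hDp0, div_mul_cancel₀ p₀ hz.ne'⟩
  obtain ⟨l₀, hl₀⟩ : ∃ l : ℝ, l = t * (p₂ / (s / 2)) := ⟨_, rfl⟩
  obtain ⟨l₁, hl₁⟩ : ∃ l : ℝ, l = t * (p₃ / x) := ⟨_, rfl⟩
  have el₀ : l₀ * (s / 2) = t * p₂ := by rw [hl₀]; field_simp
  have el₁ : l₁ * x = t * p₃ := by rw [hl₁]; field_simp
  have e0 : l₀ * (1 - s / 2) + l₁ * (1 - x) = p₀ := by rw [← htD, hl₀, hl₁, hD]; ring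
  have hsk2 : s * (k : ℝ) ≤ 2 * k := mul_le_mul_of_nonneg_right h2 hk0
  refine ⟨Fin 5, inferInstance, ![l₀, l₁, p₁, (1 - t) * p₂, (1 - t) * p₃], ![s / 2, x, 1, 1, 1], ![0, 0, k, 2 * k, 3 * k],
    ![2 * k, 3 * k, k, 2 * k, 3 * k], ?_, ?_, ?_, ?_, ?_, fun h => ?_, ?_⟩
  · intro i; fin_cases i
    · show 0 ≤ l₀; rw [hl₀]; exact mul_nonneg ht0 (div_nonneg hp₂0 hγ₂0.le)
    · show 0 ≤ l₁; rw [hl₁]; exact mul_nonneg ht0 (div_nonneg hp₃0 hx0.le)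
    · exact hp₁0
    · exact mul_nonneg (by linarith) hp₂0
    · exact mul_nonneg (by linarith) hp₃0
  · rw [Fin.sum_univ_five]
    show l₀ + l₁ + p₁ + (1 - t) * p₂ + (1 - t) * p₃ = 1
    have e : l₀ + l₁ = t * D + t * (p₂ + p₃) := by
      rw [hl₀, hl₁, hD]; field_simp; ring
    linear_combination e + htD + hsum
  · intro i; fin_cases i
    · exact ⟨hγ₂0.le, hγ₂1⟩
    · exact ⟨hx0.le, hx1.le⟩
    · exact ⟨zero_le_one, le_rfl⟩
    · exact ⟨zero_le_one, le_rfl⟩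
    · exact ⟨zero_le_one, le_rfl⟩
  · intro i; fin_cases i
    · exact Nat.zero_le _
    · exact Nat.zero_le _
    · exact le_rfl
    · exact le_rfl
    · exact le_rfl
  · intro i; fin_cases i
    · show 2 * k ≤ 3 * k; omega
    · exact le_rfl
    · show k ≤ 3 * k; omega
    · show 2 * k ≤ 3 * k; omega
    · exact le_rfl
  · rw [Fin.sum_univ_five]
    show _ = l₀ * TP[0, 2 * k, s / 2, h] + l₁ * TP[0, 3 * k, x, h] + p₁ * TP[k, k, (1 : ℝ), h]
      + (1 - t) * p₂ * TP[2 * k, 2 * k, (1 : ℝ), h] + (1 - t) * p₃ * TP[3 * k, 3 * k, (1 : ℝ), h]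
    linear_combination (-(if h = 0 then (1 : ℝ) else 0)) * e0 - (if h = 2 * k then (1 : ℝ) else 0) * el₀
      - (if h = 3 * k then (1 : ℝ) else 0) * el₁
  · intro i hi
    clear hi
    fin_cases i
    · show s / 3 ≤ s / 2 ∧ s * k ≤ 2 * ((0 : ℕ) : ℝ) + (((2 * k : ℕ) : ℝ) - ((0 : ℕ) : ℝ)) * (s / 2)
      rw [c2k]; push_cast
      exact ⟨by linarith, by linarith⟩
    · show s / 3 ≤ x ∧ s * k ≤ 2 * ((0 : ℕ) : ℝ) + (((3 * k : ℕ) : ℝ) - ((0 : ℕ) : ℝ)) * x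
      rw [c3k, hx]; push_cast
      exact ⟨le_rfl, by linarith⟩
    · show s / 3 ≤ 1 ∧ s * k ≤ 2 * (k : ℝ) + ((k : ℝ) - k) * 1
      exact ⟨by linarith, by linarith⟩
    · show s / 3 ≤ 1 ∧ s * k ≤ 2 * ((2 * k : ℕ) : ℝ) + (((2 * k : ℕ) : ℝ) - ((2 * k : ℕ) : ℝ)) * 1
      rw [c2k]
      exact ⟨by linarith, by linarith⟩
    · show s / 3 ≤ 1 ∧ s * k ≤ 2 * ((3 * k : ℕ) : ℝ) + (((3 * k : ℕ) : ℝ) - ((3 * k : ℕ) : ℝ)) * 1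
      rw [c3k]
      exact ⟨by linarith, by linarith⟩

/-- regime `2 < s < 3`: the lows `0` and `k` ship to `3k` and to `2k`, `3k` at the floor gate `x = s/3`, given the two capacity
inequalities `x·p₀ ≤ (1−x)·p₃` and `x·(p₀+p₁) ≤ (1−x)·(p₂+p₃)`. [this work] -/
theorem heavy_fourAtoms_large (k : ℕ) (p₀ p₁ p₂ p₃ s : ℝ) (hp₀0 : 0 ≤ p₀) (hp₁0 : 0 ≤ p₁) (hp₂0 : 0 ≤ p₂)
    (_hp₃0 : 0 ≤ p₃) (hsum : p₀ + p₁ + p₂ + p₃ = 1) (_hmean : p₁ + 2 * p₂ + 3 * p₃ = s) (hs0 : 0 < s) (_h2 : 2 < s) (hs3 : s < 3)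
    (hA : s / 3 * p₀ ≤ (1 - s / 3) * p₃) (hB : s / 3 * (p₀ + p₁) ≤ (1 - s / 3) * (p₂ + p₃)) :
    ∃ (ι : Type) (_ : Fintype ι) (lam γ : ι → ℝ) (lo hi : ι → ℕ),
      (∀ i, 0 ≤ lam i) ∧ (∑ i, lam i = 1) ∧ (∀ i, 0 ≤ γ i ∧ γ i ≤ 1) ∧ (∀ i, lo i ≤ hi i) ∧ (∀ i, hi i ≤ 3 * k) ∧
      (∀ h, (p₀ * (if h = 0 then (1 : ℝ) else 0) + p₁ * (if h = k then (1 : ℝ) else 0) + p₂ * (if h = 2 * k then (1 : ℝ) else 0)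
          + p₃ * (if h = 3 * k then (1 : ℝ) else 0)) = ∑ i, lam i * TP[lo i, hi i, γ i, h]) ∧
      (∀ i, 0 < lam i → s / 3 ≤ γ i ∧ s * k ≤ 2 * (lo i : ℝ) + ((hi i : ℝ) - lo i) * γ i) := by
  have hk0 : (0 : ℝ) ≤ k := Nat.cast_nonneg k
  have hsne : s ≠ 0 := hs0.ne'
  have c2k : ((2 * k : ℕ) : ℝ) = 2 * (k : ℝ) := by push_cast; ring
  have c3k : ((3 * k : ℕ) : ℝ) = 3 * (k : ℝ) := by push_cast; ring
  obtain ⟨x, hx⟩ : ∃ x : ℝ, x = s / 3 := ⟨_, rfl⟩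
  rw [← hx] at hA hB
  have hx0 : 0 < x := by rw [hx]; positivity
  have hx1 : x < 1 := by rw [hx]; linarith
  have h1x : 0 < 1 - x := by linarith
  have hxne : x ≠ 0 := hx0.ne'
  have h1xne : 1 - x ≠ 0 := h1x.ne'
  have e3x : s = 3 * x := by rw [hx]; ring
  have hxk : x * (k : ℝ) ≤ k := mul_le_of_le_one_left hk0 hx1.le
  obtain ⟨l₀, hl₀⟩ : ∃ l : ℝ, l = p₀ / (1 - x) := ⟨_, rfl⟩
  have el₀ : l₀ * (1 - x) = p₀ := by rw [hl₀]; exact div_mul_cancel₀ p₀ h1x.ne'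
  have hl₀0 : 0 ≤ l₀ := by rw [hl₀]; exact div_nonneg hp₀0 h1x.le
  by_cases hsub : x * p₁ ≤ (1 - x) * p₂
  · -- (a): all of `k` into `2k`
    obtain ⟨l₁, hl₁⟩ : ∃ l : ℝ, l = p₁ / (1 - x) := ⟨_, rfl⟩
    have el₁ : l₁ * (1 - x) = p₁ := by rw [hl₁]; exact div_mul_cancel₀ p₁ h1x.ne'
    have hl₁0 : 0 ≤ l₁ := by rw [hl₁]; exact div_nonneg hp₁0 h1x.le
    have hr₂ : 0 ≤ p₂ - l₁ * x := by
      have : l₁ * x = x * p₁ / (1 - x) := by rw [hl₁]; ring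
      rw [this, sub_nonneg, div_le_iff₀ h1x]; linarith
    have hr₃ : 0 ≤ p₃ - l₀ * x := by
      have : l₀ * x = x * p₀ / (1 - x) := by rw [hl₀]; ring
      rw [this, sub_nonneg, div_le_iff₀ h1x]; linarith
    refine ⟨Fin 4, inferInstance, ![l₀, l₁, p₂ - l₁ * x, p₃ - l₀ * x], ![x, x, 1, 1], ![0, k, 2 * k, 3 * k],
      ![3 * k, 2 * k, 2 * k, 3 * k], ?_, ?_, ?_, ?_, ?_, fun h => ?_, ?_⟩
    · intro i; fin_cases i
      · exact hl₀0
      · exact hl₁0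
      · exact hr₂
      · exact hr₃
    · rw [Fin.sum_univ_four]
      show l₀ + l₁ + (p₂ - l₁ * x) + (p₃ - l₀ * x) = 1
      linear_combination el₀ + el₁ + hsum
    · intro i; fin_cases i
      · exact ⟨hx0.le, hx1.le⟩
      · exact ⟨hx0.le, hx1.le⟩
      · exact ⟨zero_le_one, le_rfl⟩
      · exact ⟨zero_le_one, le_rfl⟩
    · intro i; fin_cases i
      · exact Nat.zero_le _
      · show k ≤ 2 * k; omega
      · exact le_rfl
      · exact le_rfl
    · intro i; fin_cases i
      · exact le_rfl
      · show 2 * k ≤ 3 * k; omega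
      · show 2 * k ≤ 3 * k; omega
      · exact le_rfl
    · rw [Fin.sum_univ_four]
      show _ = l₀ * TP[0, 3 * k, x, h] + l₁ * TP[k, 2 * k, x, h] + (p₂ - l₁ * x) * TP[2 * k, 2 * k, (1 : ℝ), h]
        + (p₃ - l₀ * x) * TP[3 * k, 3 * k, (1 : ℝ), h]
      linear_combination (-(if h = 0 then (1 : ℝ) else 0)) * el₀ - (if h = k then (1 : ℝ) else 0) * el₁
    · intro i hi
      clear hi
      fin_cases i
      · show s / 3 ≤ x ∧ s * k ≤ 2 * ((0 : ℕ) : ℝ) + (((3 * k : ℕ) : ℝ) - ((0 : ℕ) : ℝ)) * x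
        rw [c3k, e3x]; push_cast
        exact ⟨by linarith, by linarith⟩
      · show s / 3 ≤ x ∧ s * k ≤ 2 * (k : ℝ) + (((2 * k : ℕ) : ℝ) - (k : ℝ)) * x
        rw [c2k, e3x]
        exact ⟨by linarith, by linarith⟩
      · show s / 3 ≤ 1 ∧ s * k ≤ 2 * ((2 * k : ℕ) : ℝ) + (((2 * k : ℕ) : ℝ) - ((2 * k : ℕ) : ℝ)) * 1
        rw [c2k, e3x]
        exact ⟨by linarith, by linarith⟩
      · show s / 3 ≤ 1 ∧ s * k ≤ 2 * ((3 * k : ℕ) : ℝ) + (((3 * k : ℕ) : ℝ) - ((3 * k : ℕ) : ℝ)) * 1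
        rw [c3k, e3x]
        exact ⟨by linarith, by linarith⟩
  · -- (b): `2k` saturated by `k`, the rest of `k` into `3k`
    obtain ⟨l₁, hl₁⟩ : ∃ l : ℝ, l = p₂ / x := ⟨_, rfl⟩
    have el₁ : l₁ * x = p₂ := by rw [hl₁]; exact div_mul_cancel₀ p₂ hx0.ne'
    have hl₁0 : 0 ≤ l₁ := by rw [hl₁]; exact div_nonneg hp₂0 hx0.le
    obtain ⟨l₂, hl₂⟩ : ∃ l : ℝ, l = (p₁ - l₁ * (1 - x)) / (1 - x) := ⟨_, rfl⟩
    have el₂ : l₂ * (1 - x) = p₁ - l₁ * (1 - x) := by rw [hl₂]; exact div_mul_cancel₀ _ h1x.ne'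
    have hl₂0 : 0 ≤ l₂ := by
      rw [hl₂]
      refine div_nonneg ?_ h1x.le
      have : l₁ * (1 - x) = (1 - x) * p₂ / x := by rw [hl₁]; ring
      rw [this, sub_nonneg, div_le_iff₀ hx0]; linarith
    have hr₃ : 0 ≤ p₃ - l₀ * x - l₂ * x := by
      have e : (1 - x) * (p₃ - l₀ * x - l₂ * x) = (1 - x) * (p₂ + p₃) - x * (p₀ + p₁) := by
        have e1 : (1 - x) * (l₀ * x) = x * p₀ := by rw [hl₀]; field_simp
        have e2 : (1 - x) * (l₂ * x) = x * (p₁ - l₁ * (1 - x)) := by rw [hl₂]; field_simp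
        have e3 : x * (l₁ * (1 - x)) = (1 - x) * p₂ := by rw [hl₁]; field_simp
        linear_combination (-1 : ℝ) * e1 - e2 + e3
      have : 0 ≤ (1 - x) * (p₃ - l₀ * x - l₂ * x) := by rw [e]; linarith
      exact nonneg_of_mul_nonneg_right this h1x
    refine ⟨Fin 4, inferInstance, ![l₀, l₁, l₂, p₃ - l₀ * x - l₂ * x], ![x, x, x, 1], ![0, k, k, 3 * k],
      ![3 * k, 2 * k, 3 * k, 3 * k], ?_, ?_, ?_, ?_, ?_, fun h => ?_, ?_⟩
    · intro i; fin_cases i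
      · exact hl₀0
      · exact hl₁0
      · exact hl₂0
      · exact hr₃
    · rw [Fin.sum_univ_four]
      show l₀ + l₁ + l₂ + (p₃ - l₀ * x - l₂ * x) = 1
      linear_combination el₀ + el₂ + el₁ + hsum
    · intro i; fin_cases i
      · exact ⟨hx0.le, hx1.le⟩
      · exact ⟨hx0.le, hx1.le⟩
      · exact ⟨hx0.le, hx1.le⟩
      · exact ⟨zero_le_one, le_rfl⟩
    · intro i; fin_cases i
      · exact Nat.zero_le _
      · show k ≤ 2 * k; omega
      · show k ≤ 3 * k; omega
      · exact le_rfl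
    · intro i; fin_cases i
      · exact le_rfl
      · show 2 * k ≤ 3 * k; omega
      · exact le_rfl
      · exact le_rfl
    · rw [Fin.sum_univ_four]
      show _ = l₀ * TP[0, 3 * k, x, h] + l₁ * TP[k, 2 * k, x, h] + l₂ * TP[k, 3 * k, x, h]
        + (p₃ - l₀ * x - l₂ * x) * TP[3 * k, 3 * k, (1 : ℝ), h]
      linear_combination (-(if h = 0 then (1 : ℝ) else 0)) * el₀ - (if h = 2 * k then (1 : ℝ) else 0) * el₁
        - (if h = k then (1 : ℝ) else 0) * el₂
    · intro i hi
      clear hi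
      fin_cases i
      · show s / 3 ≤ x ∧ s * k ≤ 2 * ((0 : ℕ) : ℝ) + (((3 * k : ℕ) : ℝ) - ((0 : ℕ) : ℝ)) * x
        rw [c3k, e3x]; push_cast
        exact ⟨by linarith, by linarith⟩
      · show s / 3 ≤ x ∧ s * k ≤ 2 * (k : ℝ) + (((2 * k : ℕ) : ℝ) - (k : ℝ)) * x
        rw [c2k, e3x]
        exact ⟨by linarith, by linarith⟩
      · show s / 3 ≤ x ∧ s * k ≤ 2 * (k : ℝ) + (((3 * k : ℕ) : ℝ) - (k : ℝ)) * x
        rw [c3k, e3x]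
        exact ⟨by linarith, by linarith⟩
      · show s / 3 ≤ 1 ∧ s * k ≤ 2 * ((3 * k : ℕ) : ℝ) + (((3 * k : ℕ) : ℝ) - ((3 * k : ℕ) : ℝ)) * 1
        rw [c3k, e3x]
        exact ⟨by linarith, by linarith⟩

end LawDec
end Quant
end Summit.CriticalPhenomena.PercolationContinuityZ3.Theorems
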